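import Summits.QuantumFields.YangMills.Theorems.IR.VacuumEscapeIteratedKernel
import Literature.Analysis.OperatorTheory.KernelCyclicPeeling
import HarnessLib

/-!
# Line `vacuum_escape` (crux `BalabanLadder.IR`, stmt-QuantumFields-19354) — physical-time currency, part 2:
# the cyclic slice-chain integral with insertions at lag `n = r + 1` as a spectral sum

Helper toward `PhysicalTimeConductance ↔ SliceGapInUnits` (census B6; ideator ym-ir-idea-8; pooled prover ym-ir-line-pool-p3).  Abstract
setting of `VacuumEscapeCheegerSpectral` (probability space `(X, μ)`, bounded symmetric strongly measurable kernel `K` with `L²` operator `A` and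
a countable Hilbert basis of eigenvectors `A bᵢ = λᵢ bᵢ`; iterated kernels `Kn` of part 1).  For bounded measurable one-site weights `f, g`,
the cyclic integral of the periodic chain of `M + r + 3` sites with `f` inserted at site `0` and `g` at the site `p` of LAG `r + 1`,

  `∫ f(V 0) g(V p) ∏ₜ K(V t, V (t+1)) dμ^{⊗} = Σᵢ λᵢ^{M+2} ⟪bᵢ, 𝒳 bᵢ⟫`      (`hasSum_cyclic_insert_lag`),

where `𝒳` is the `L²` operator of the bounded kernel `f(x) K⁽ʳ⁺¹⁾(x,y) g(y)` (`K⁽ʳ⁺¹⁾ = Kn r`), i.e. `Tr(f Aʳ⁺¹ g A^{M+2})`; from the tree's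
`KernelCyclicPeeling.integral_cyclic_eq_integral_iterate` (cut the cycle at site `0`, peel both arcs into kernel iterates), part 1
(`iterate_op_eq_integral_iterK`: iterates are integrals against `Kn`) and `PositiveKernelSpectralTrace.hasSum_integral_iterate_insert_one`.
Matrix elements: `⟪bᵢ, 𝒳 bᵢ⟫ = ∫ f bᵢ (x) ∫ Kn r (x,y) g(y) bᵢ(y)` (`inner_lagOp_eq`).  With `f = g = 1_A` these are the numerators of the lag-`n`
slice-chain probability `sliceStayN` of line `vacuum_escape` (part 3 takes `m → ∞`).  [folklore: transfer-operator bookkeeping]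

HONEST FRAMING: bookkeeping for one format equivalence; nothing here bears on weak coupling, `BalabanLadder.IR`, or the Yang–Mills mass gap
(Clay); R4 of the ladder closes only `BalabanLadder.UV`.
-/

set_option autoImplicit false

noncomputable section

open MeasureTheory Filter Set Function
open scoped RealInnerProductSpace ENNReal Topology
open Literature.Analysis.OperatorTheory
open Summit.QuantumFields.YangMills.Cruxes.IR.VacuumEscape.IterKernel

namespace Summit.QuantumFields.YangMills.Cruxes.IR.VacuumEscape.LagSpectral

variable {X : Type*} [MeasurableSpace X] {μ : Measure X} [IsProbabilityMeasure μ]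
  {K : X → X → ℝ} {C : ℝ} {Kn : ℕ → X → X → ℝ} {A : Lp ℝ 2 μ →L[ℝ] Lp ℝ 2 μ} {ι : Type*}
  {b : HilbertBasis ι ℝ (Lp ℝ 2 μ)} {lam : ι → ℝ}

/-- The closing arc is an iterated kernel read backwards: `(κ^[j+1] K(·,x))(y) = Kn (j+1) y x`. [folklore] -/
theorem iterate_section_eq_iterK (hK : Measurable (uncurry K)) (hC : ∀ x y, ‖K x y‖ ≤ C) (hK0 : Kn 0 = K)
    (hKs : ∀ j x y, Kn (j + 1) x y = ∫ z, K x z * Kn j z y ∂μ) (j : ℕ) (x y : X) :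
    (fun f : X → ℝ => fun w => ∫ z, K w z * f z ∂μ)^[j + 1] (fun z => K z x) y = Kn (j + 1) y x := by
  have hKx : Measurable fun z => K z x := hK.comp (measurable_id.prodMk measurable_const)
  rw [iterate_op_eq_integral_iterK (μ := μ) hK hC hK0 hKs hKx (fun z => hC z x) j y,
    iterK_succ_right (μ := μ) hK hC hK0 hKs j y x]

/-- The lag kernel `f(x) Kn r (x,y) g(y)` is jointly (strongly) measurable. [folklore] -/
theorem stronglyMeasurable_lagKernel (hK : Measurable (uncurry K)) (hC : ∀ x y, ‖K x y‖ ≤ C) (hK0 : Kn 0 = K)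
    (hKs : ∀ j x y, Kn (j + 1) x y = ∫ z, K x z * Kn j z y ∂μ) {f g : X → ℝ} (hf : Measurable f)
    (hg : Measurable g) (r : ℕ) : StronglyMeasurable (uncurry fun x y => f x * Kn r x y * g y) := by
  obtain ⟨hm, -⟩ := measurable_bdd_iterK (μ := μ) hK hC hK0 hKs r
  exact (((hf.comp measurable_fst).mul hm).mul (hg.comp measurable_snd)).stronglyMeasurable

/-- The lag kernel is bounded by `B_f C^{r+1} B_g`. [folklore] -/
theorem norm_lagKernel_le (hK : Measurable (uncurry K)) (hC : ∀ x y, ‖K x y‖ ≤ C) (hK0 : Kn 0 = K)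
    (hKs : ∀ j x y, Kn (j + 1) x y = ∫ z, K x z * Kn j z y ∂μ) {f g : X → ℝ} {Bf Bg : ℝ}
    (hfb : ∀ x, ‖f x‖ ≤ Bf) (hgb : ∀ x, ‖g x‖ ≤ Bg) (r : ℕ) (x y : X) :
    ‖f x * Kn r x y * g y‖ ≤ Bf * C ^ (r + 1) * Bg := by
  obtain ⟨-, hb⟩ := measurable_bdd_iterK (μ := μ) hK hC hK0 hKs r
  have hBf : 0 ≤ Bf := (norm_nonneg _).trans (hfb x)
  have hC0 : 0 ≤ C ^ (r + 1) := (norm_nonneg _).trans (hb x y)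
  rw [norm_mul, norm_mul]
  exact mul_le_mul (mul_le_mul (hfb x) (hb x y) (norm_nonneg _) hBf) (hgb y) (norm_nonneg _) (mul_nonneg hBf hC0)

variable [Countable ι]

/-- **Cyclic integral with insertions at lag `r + 1` = spectral sum.**  On the cycle `Fin (M+1+1+r+1)` with the periodic weight
`∏ₜ K(V t, V (t+1))`, `f` at site `0` and `g` at the site `p` with `p = r + 1`:
`Σᵢ λᵢ^{M+2} ⟪bᵢ, 𝒳 bᵢ⟫ = ∫ f(V 0) g(V p) ∏ₜ K(V t, V (t+1)) dμ^{⊗}`, `𝒳` the `L²` operator of `f(x) Kn r (x,y) g(y)`. [folklore] -/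
theorem hasSum_cyclic_insert_lag (hK : StronglyMeasurable (uncurry K)) (hC : ∀ x y, ‖K x y‖ ≤ C)
    (hsymm : ∀ x y, K x y = K y x) (hA : ∀ φ : Lp ℝ 2 μ, (A φ : X → ℝ) =ᵐ[μ] fun x => ∫ y, K x y * φ y ∂μ)
    (hb : ∀ i, A (b i) = lam i • b i) (hK0 : Kn 0 = K)
    (hKs : ∀ j x y, Kn (j + 1) x y = ∫ z, K x z * Kn j z y ∂μ) {f g : X → ℝ} (hf : Measurable f)
    (hg : Measurable g) {Bf Bg : ℝ} (hfb : ∀ x, ‖f x‖ ≤ Bf) (hgb : ∀ x, ‖g x‖ ≤ Bg) (r : ℕ)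
    {Xop : Lp ℝ 2 μ →L[ℝ] Lp ℝ 2 μ}
    (hXop : ∀ φ : Lp ℝ 2 μ, (Xop φ : X → ℝ) =ᵐ[μ] fun x => ∫ y, (f x * Kn r x y * g y) * φ y ∂μ) (M : ℕ)
    (p : Fin (M + 1 + 1 + r + 1)) (hp : (p : ℕ) = r + 1) :
    HasSum (fun i => lam i ^ (M + 2) * ⟪b i, Xop (b i)⟫)
      (∫ V : Fin (M + 1 + 1 + r + 1) → X, f (V 0) * g (V p) * ∏ t, K (V t) (V (t + 1))
        ∂(Measure.pi fun _ => μ)) := by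
  have hKm : Measurable (uncurry K) := hK.measurable
  have hXm := stronglyMeasurable_lagKernel (μ := μ) hKm hC hK0 hKs hf hg r
  have hXb := norm_lagKernel_le (μ := μ) hKm hC hK0 hKs hfb hgb r
  have hS := hasSum_integral_iterate_insert_one (μ := μ) hK hC hsymm hA hb hXm hXb hXop M
  -- identify the two integrals
  have hcyc := integral_cyclic_eq_integral_iterate (ρ := μ) hKm hC (M + 1) r hf hg hfb hgb p hp
  rw [hcyc]
  -- the closing arc as `Kn (M+1)`
  have hiter : ∀ x y, (fun f : X → ℝ => fun w => ∫ z, K w z * f z ∂μ)^[M + 1] (fun z => K z x) y = Kn (M + 1) y x :=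
    fun x y => iterate_section_eq_iterK (μ := μ) hKm hC hK0 hKs M x y
  obtain ⟨hmM, hbM⟩ := measurable_bdd_iterK (μ := μ) hKm hC hK0 hKs (M + 1)
  have key : ∀ x, f x * (fun f : X → ℝ => fun w => ∫ z, K w z * f z ∂μ)^[r + 1]
      (fun y => g y * (fun f : X → ℝ => fun w => ∫ z, K w z * f z ∂μ)^[M + 1] (fun z => K z x) y) x =
      ∫ y, (f x * Kn r x y * g y) *
        (fun f : X → ℝ => fun w => ∫ z, K w z * f z ∂μ)^[M + 1] (fun z => K z x) y ∂μ := by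
    intro x
    have hψm : Measurable fun y => g y * (fun f : X → ℝ => fun w => ∫ z, K w z * f z ∂μ)^[M + 1] (fun z => K z x) y := by
      have e : (fun y => g y * (fun f : X → ℝ => fun w => ∫ z, K w z * f z ∂μ)^[M + 1] (fun z => K z x) y) =
          fun y => g y * Kn (M + 1) y x := by funext y; rw [hiter x y]
      rw [e]
      exact hg.mul (hmM.comp (measurable_id.prodMk measurable_const))
    have hψb : ∀ y, ‖g y * (fun f : X → ℝ => fun w => ∫ z, K w z * f z ∂μ)^[M + 1] (fun z => K z x) y‖ ≤
        Bg * C ^ (M + 1 + 1) := by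
      intro y
      rw [hiter x y, norm_mul]
      exact mul_le_mul (hgb y) (hbM y x) (norm_nonneg _) ((norm_nonneg _).trans (hgb y))
    rw [iterate_op_eq_integral_iterK (μ := μ) hKm hC hK0 hKs hψm hψb r x, ← integral_const_mul]
    refine integral_congr_ae (Eventually.of_forall fun y => ?_)
    ring
  simp_rw [key]
  exact hS

omit [IsProbabilityMeasure μ] [Countable ι] in
/-- **Matrix elements of the lag operator**: `⟪bᵢ, 𝒳 bᵢ⟫ = ∫ f(x) bᵢ(x) (∫ Kn r (x,y) g(y) bᵢ(y) dμ(y)) dμ(x)`. -/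
theorem inner_lagOp_eq {f g : X → ℝ} {r : ℕ} {Xop : Lp ℝ 2 μ →L[ℝ] Lp ℝ 2 μ}
    (hXop : ∀ φ : Lp ℝ 2 μ, (Xop φ : X → ℝ) =ᵐ[μ] fun x => ∫ y, (f x * Kn r x y * g y) * φ y ∂μ) (i : ι) :
    ⟪b i, Xop (b i)⟫ = ∫ x, f x * b i x * ∫ y, Kn r x y * (g y * b i y) ∂μ ∂μ := by
  rw [inner_kernelOp_eq_integral hXop]
  refine integral_congr_ae (Eventually.of_forall fun x => ?_)
  simp only
  rw [← integral_const_mul, ← integral_const_mul]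
  refine integral_congr_ae (Eventually.of_forall fun y => ?_)
  ring

end Summit.QuantumFields.YangMills.Cruxes.IR.VacuumEscape.LagSpectral

end
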